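import Summits.Ventures.DiscreteObjects.Hadamard.Frobenius83Row

/-!
# Hadamard 668 census, family F12 — the Frobenius classes `Z₂₃ ⋊ Z₁₁` and `Z₂₃ ⋊ Z₂₂` in the kernel

Framing: lottery ticket; floor = certified bounds/negative ranges.

Cell pub-namedobj (venture DiscreteObjects), target (H), hadamard gen 4, family F12 (FAMILY-F12.md): the symmetric
2-(667,333,166) design (⇔ a Hadamard matrix of order 668) with a Frobenius automorphism group `Z_p ⋊ U`, all orbits of
length 1 or `p`, minimal fixed structure.  For `p = 23` (`667 = 29·23`, no fixed points) and `U ⊇` the squares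
`⟨4⟩ ≤ (ℤ/23)ˣ` (order 11), one point-orbit row of the incidence matrix becomes 29 `0/1` functions
`x_j : ZMod 23 → {0,1}` invariant under `i ↦ 4 i`, with `Σ_j |x_j| = 333` and `Σ_j PAF_(x_j)(s) = 166` for every `s ≠ 0`
(FAMILY-F12 §2).  Here `m = 29 > p - 2`, so the uniform argument of `Frobenius83Row`/`37Row`/`29Row` does not apply; instead
this file COUNTS: each block has profile `(|x|, PAF_x(1)) ∈ {(0,0), (1,0), (11,5), (12,6), (22,21), (23,23)}` (`blk23_profile`,
by `decide` after the structure lemma `eq_blk23`), the six multiplicities `c₀,…,c₅ ≥ 0` satisfy `Σ c = 29`,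
`c₁ + 11c₂ + 12c₃ + 22c₄ + 23c₅ = 333`, `5c₂ + 6c₃ + 21c₄ + 23c₅ = 166`, and this integer system has no solution: `c₄, c₅ ≤ 1`
(from `c₁ + c₂ = 1 + 20c₄ + 23c₅ ≤ 29`), then `omega` in each of the four cases (`no_frobenius23_row`; the hand version is the
case analysis of FAMILY-F12 §3).  Three independent enumerations in
the cell agree.  Ours, not literature; no `sorry`, no `native_decide`.
-/

open Finset BigOperators

namespace Summit.Ventures.DiscreteObjects.Hadamard

open Literature.Combinatorics.Designs.LegendrePairs (PAF)

/-! ## §1 The orbit of the multiplier `4` on `ZMod 23` (tables, kernel-checked) -/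

/-- `orb23 k = 4^k` in `ZMod 23` (`4` generates the 11 non-zero squares) -/
def orb23 : ℕ → ZMod 23
  | 0 => 1
  | k + 1 => 4 * orb23 k

/-- discrete-logarithm table for `ZMod 23` (`orb23 (dlog23[i]) = i` for squares, `= -i` for non-squares) -/
def dlog23 : List ℕ := [0, 0, 6, 4, 1, 3, 10, 2, 7, 8, 9, 5, 5, 9, 8, 7, 2, 10, 3, 1, 4, 6, 0]

/-- bit mask of the 11 non-zero squares modulo 23 -/
def qrMask23 : ℕ := 340830

/-- `i` is a non-zero quadratic residue mod 23 (table lookup) -/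
def isQR23 (i : ZMod 23) : Bool := Nat.testBit qrMask23 i.val

set_option maxRecDepth 100000 in
/-- kernel check of both tables -/
theorem orbit_cover23 : ∀ i : ZMod 23,
    i = 0 ∨ (isQR23 i = true ∧ orb23 (dlog23.getD i.val 0) = i) ∨ (isQR23 i = false ∧ orb23 (dlog23.getD i.val 0) = -i) := by
  decide

/-- invariance under `i ↦ 4 i` propagates along the orbit walk, from `1` and from `-1` -/
lemma apply_orb23 {α : Type*} (x : ZMod 23 → α) (hinv : ∀ i, x (4 * i) = x i) (k : ℕ) :
    x (orb23 k) = x 1 ∧ x (-orb23 k) = x (-1) := by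
  induction k with
  | zero => simp [orb23]
  | succ k ih =>
    refine ⟨?_, ?_⟩
    · show x (4 * orb23 k) = x 1
      rw [hinv]; exact ih.1
    · show x (-(4 * orb23 k)) = x (-1)
      rw [← mul_neg, hinv]; exact ih.2

/-- the three-valued block on `ZMod 23` -/
def blk23 {α : Type*} (e0 e1 e2 : α) (i : ZMod 23) : α :=
  if i = 0 then e0 else if isQR23 i = true then e1 else e2

/-- a `4`-invariant function on `ZMod 23` is the block of its values at `0`, `1` and `-1` -/
theorem eq_blk23 {α : Type*} (x : ZMod 23 → α) (hinv : ∀ i, x (4 * i) = x i) :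
    x = blk23 (x 0) (x 1) (x (-1)) := by
  funext i
  by_cases hi : i = 0
  · subst hi; simp [blk23]
  · rcases orbit_cover23 i with h0 | ⟨hq, he⟩ | ⟨hq, he⟩
    · exact absurd h0 hi
    · have h := (apply_orb23 x hinv (dlog23.getD i.val 0)).1
      rw [he] at h
      unfold blk23; rw [if_neg hi, if_pos hq]; exact h
    · have h := (apply_orb23 x hinv (dlog23.getD i.val 0)).2
      rw [he, neg_neg] at h
      have hq' : ¬ (isQR23 i = true) := by rw [hq]; exact Bool.false_ne_true
      unfold blk23; rw [if_neg hi, if_neg hq']; exact h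

/-! ## §2 The six profiles (kernel-checked) -/

set_option maxRecDepth 100000 in
/-- the profile `(PAF(0), PAF(1))` of a `0/1` block on `ZMod 23` is one of six pairs -/
theorem blk23_profile : ∀ e0 ∈ [(0 : ℤ), 1], ∀ e1 ∈ [(0 : ℤ), 1], ∀ e2 ∈ [(0 : ℤ), 1],
    (PAF (blk23 e0 e1 e2) 0 = 0 ∧ PAF (blk23 e0 e1 e2) 1 = 0) ∨ (PAF (blk23 e0 e1 e2) 0 = 1 ∧ PAF (blk23 e0 e1 e2) 1 = 0) ∨
    (PAF (blk23 e0 e1 e2) 0 = 11 ∧ PAF (blk23 e0 e1 e2) 1 = 5) ∨ (PAF (blk23 e0 e1 e2) 0 = 12 ∧ PAF (blk23 e0 e1 e2) 1 = 6) ∨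
    (PAF (blk23 e0 e1 e2) 0 = 22 ∧ PAF (blk23 e0 e1 e2) 1 = 21) ∨ (PAF (blk23 e0 e1 e2) 0 = 23 ∧ PAF (blk23 e0 e1 e2) 1 = 23) := by
  decide

/-- for a `0/1` function on `ZMod 23`, `PAF_x(0) = Σ_i x_i` -/
lemma paf_zero_01_23 (x : ZMod 23 → ℤ) (h01 : ∀ i, x i = 0 ∨ x i = 1) : PAF x 0 = ∑ i, x i := by
  unfold PAF
  refine Finset.sum_congr rfl fun i _ => ?_
  rw [add_zero]
  rcases h01 i with h | h <;> rw [h] <;> norm_num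

/-! ## §3 Counting the blocks by profile, then `omega` -/

/-- indicator of `a = b` as an integer -/
def indEq (a b : ℤ) : ℤ := if a = b then 1 else 0

/-- **Family F12, classes `Z₂₃ ⋊ Z₁₁` and `Z₂₃ ⋊ Z₂₂` (kernel certificate of the row system).**  There are no 29 `0/1`
functions on `ZMod 23`, invariant under the squares `⟨4⟩`, with `Σ_j |x_j| = 333` and `Σ_j PAF_(x_j)(1) = 166`. -/
theorem no_frobenius23_row (x : Fin 29 → ZMod 23 → ℤ) (h01 : ∀ j i, x j i = 0 ∨ x j i = 1)
    (hinv : ∀ j i, x j (4 * i) = x j i)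
    (hw : ∑ j, ∑ i, x j i = 333) (hP : ∑ j, PAF (x j) 1 = 166) : False := by
  -- per-block profile
  have hb : ∀ j, (PAF (x j) 0 = 0 ∧ PAF (x j) 1 = 0) ∨ (PAF (x j) 0 = 1 ∧ PAF (x j) 1 = 0) ∨
      (PAF (x j) 0 = 11 ∧ PAF (x j) 1 = 5) ∨ (PAF (x j) 0 = 12 ∧ PAF (x j) 1 = 6) ∨
      (PAF (x j) 0 = 22 ∧ PAF (x j) 1 = 21) ∨ (PAF (x j) 0 = 23 ∧ PAF (x j) 1 = 23) := by
    intro j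
    have := blk23_profile (x j 0) (mem_01 (h01 j 0)) (x j 1) (mem_01 (h01 j 1)) (x j (-1)) (mem_01 (h01 j (-1)))
    rw [← eq_blk23 (x j) (hinv j)] at this
    exact this
  have hw' : ∑ j, PAF (x j) 0 = 333 := by
    rw [Finset.sum_congr rfl (fun j _ => paf_zero_01_23 (x j) (h01 j))]; exact hw
  -- each block decomposes over the six profiles
  have hdec : ∀ j,
      indEq (PAF (x j) 0) 0 + indEq (PAF (x j) 0) 1 + indEq (PAF (x j) 0) 11 + indEq (PAF (x j) 0) 12 +
          indEq (PAF (x j) 0) 22 + indEq (PAF (x j) 0) 23 = 1 ∧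
      PAF (x j) 0 = indEq (PAF (x j) 0) 1 + 11 * indEq (PAF (x j) 0) 11 + 12 * indEq (PAF (x j) 0) 12 +
          22 * indEq (PAF (x j) 0) 22 + 23 * indEq (PAF (x j) 0) 23 ∧
      PAF (x j) 1 = 5 * indEq (PAF (x j) 0) 11 + 6 * indEq (PAF (x j) 0) 12 + 21 * indEq (PAF (x j) 0) 22 +
          23 * indEq (PAF (x j) 0) 23 := by
    intro j
    rcases hb j with ⟨h0, h1⟩ | ⟨h0, h1⟩ | ⟨h0, h1⟩ | ⟨h0, h1⟩ | ⟨h0, h1⟩ | ⟨h0, h1⟩ <;>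
      simp [indEq, h0, h1]
  -- the six multiplicities
  have hcount : ∑ j : Fin 29, (indEq (PAF (x j) 0) 0 + indEq (PAF (x j) 0) 1 + indEq (PAF (x j) 0) 11 +
      indEq (PAF (x j) 0) 12 + indEq (PAF (x j) 0) 22 + indEq (PAF (x j) 0) 23) = 29 := by
    rw [Finset.sum_congr rfl (fun j _ => (hdec j).1)]; simp
  have hW : ∑ j : Fin 29, (indEq (PAF (x j) 0) 1 + 11 * indEq (PAF (x j) 0) 11 + 12 * indEq (PAF (x j) 0) 12 +
      22 * indEq (PAF (x j) 0) 22 + 23 * indEq (PAF (x j) 0) 23) = 333 := by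
    rw [← Finset.sum_congr rfl (fun j _ => (hdec j).2.1)]; exact hw'
  have hPP : ∑ j : Fin 29, (5 * indEq (PAF (x j) 0) 11 + 6 * indEq (PAF (x j) 0) 12 + 21 * indEq (PAF (x j) 0) 22 +
      23 * indEq (PAF (x j) 0) 23) = 166 := by
    rw [← Finset.sum_congr rfl (fun j _ => (hdec j).2.2)]; exact hP
  -- name the six counts and their non-negativity
  have hnn : ∀ v : ℤ, 0 ≤ ∑ j : Fin 29, indEq (PAF (x j) 0) v := fun v =>
    Finset.sum_nonneg fun j _ => by unfold indEq; split_ifs <;> norm_num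
  have e0 := hnn 0; have e1 := hnn 1; have e11 := hnn 11; have e12 := hnn 12; have e22 := hnn 22; have e23 := hnn 23
  simp only [Finset.sum_add_distrib, ← Finset.mul_sum] at hcount hW hPP
  -- name the counts, then a small case analysis (Lean's `omega` has no dark shadow, so we split the two large profiles)
  generalize ∑ j : Fin 29, indEq (PAF (x j) 0) 0 = c0 at *
  generalize ∑ j : Fin 29, indEq (PAF (x j) 0) 1 = c1 at *
  generalize ∑ j : Fin 29, indEq (PAF (x j) 0) 11 = c11 at *
  generalize ∑ j : Fin 29, indEq (PAF (x j) 0) 12 = c12 at *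
  generalize ∑ j : Fin 29, indEq (PAF (x j) 0) 22 = c22 at *
  generalize ∑ j : Fin 29, indEq (PAF (x j) 0) 23 = c23 at *
  have h22 : c22 ≤ 1 := by omega
  have h23 : c23 ≤ 1 := by omega
  interval_cases c22 <;> interval_cases c23 <;> omega

end Summit.Ventures.DiscreteObjects.Hadamard
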